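import Literature.NumberTheory.GaloisCohomology.TateEulerCharacteristicBaseOfKummer
import Literature.NumberTheory.GaloisCohomology.TateEulerCharacteristicKummerClasses
import Literature.NumberTheory.GaloisCohomology.TateGlobalEulerCharacteristicTCOfBase
import Literature.NumberTheory.GaloisCohomology.RestrictedRamificationFiniteCohomologyTotallyComplex
import HarnessLib

/-!
# Tate's global Euler characteristic at a totally complex field: the base case `hbase` from the
# Brauer-class identity (composition of the ADAPTER with the Kummer class identity)

Topic `NumberTheory/GaloisCohomology`; namespace `Literature.NumberTheory.GaloisCohomology`.  Theorems
only; no definition, no named fact, no `sorry`, no instance, no notation.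

`baseK_of_brauerClass`: the hypothesis `hbase` of
`TateGlobalEulerCharacteristicTCOfBase.tateGlobalEulerPoincareCharacteristic_of_isTotallyComplex_of_base`
(the cyclic prime-to-`p` base case of Tate's formula at a totally complex `K`, for all `S`, `p`, `W`, `C`,
`M`) follows from ONE family of identities: for every open `H ≤ Γ_K` above `N_S` and every finite Galois
layer `E` of `K_S` over `K̄^H`, the Brauer-class identity `ψ(𝓗²(E_S)[p]) + ψ(𝔽_p) = ψ(𝔽_p[S_f(E)])` for
all additive invariants `ψ` of finite `p`-torsion `ℤ[Gal(E/K̄^H)]`-modules (hypothesis `hBr`, the `hH2`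
of `TateEulerCharacteristicKummerClasses`).  Composition: `TateEulerCharacteristicBaseOfKummer.baseK_of_layerIdentity`
(the adapter: `H := π⁻¹ U`, the layer cut out by `W`, `E_S[p]` as the model of `μ_p`, finiteness, the
degree-`0` and exponent conversions, the model-free Euler-characteristic computation) ∘
`TateEulerCharacteristicKummerClasses.additive_coindOpen_mu_euler_of_brauerClass` (the Kummer pieces,
`E_S^W = 𝒪ˣ_{E,S}`, the equivariant `S`-unit theorem mod `p`, the archimedean places over a totally
complex base).

Lane «TATE-EPC-TC» (cell `bsd-eis`, crux `GoodLatticeBDPValue`, stmt-BirchSwinnertonDyer-19032).  HONEST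
FRAMING: conditional on `hBr` (delivered by the invariant-vector file of the lane); with it, the lane
closer `tateGlobalEulerPoincareCharacteristic_of_isTotallyComplex` is
`…_of_isTotallyComplex_of_base K (forall_finite_restrictedCohomology_of_isTotallyComplex K) (baseK_of_brauerClass K hBr)`.
No case of BSD is proved here.  `tateGlobalEulerPoincareCharacteristic_of_isTotallyComplex_of_brauerClass`
(appended) spells the composite out: Milne ADT I Thm. 5.1 at a totally complex `K` GIVEN `hBr`.

## References
* J. S. Milne, *Arithmetic Duality Theorems*, 2nd ed. (2006), I Thm. 5.1 (proof, pp. 69–70). [MilneADT2006]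
* J. Neukirch, A. Schmidt, K. Wingberg, *Cohomology of Number Fields*, 2nd ed. (2008), (8.7.4), (8.3.11).
  [NeukirchSchmidtWingberg2008]
* J. W. S. Cassels, A. Fröhlich (eds.), *Algebraic Number Theory* (1967), Ch. VII (Tate) §7.3 Cor. 7.4 (b).
  [CasselsFrohlichANT1967]
-/

noncomputable section

open CategoryTheory Function
open scoped Topology

namespace Literature.NumberTheory.GaloisCohomology

open Literature.NumberTheory.GaloisRepresentations
open Literature.NumberTheory.GaloisRepresentations.DiscreteGaloisModule (mu MuCarrier)
open Literature.NumberTheory.GaloisRepresentations.OpenSubgroupLayer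
open Literature.NumberTheory.GaloisRepresentations.IdeleClassBar (GalLayer)
open Literature.NumberTheory.GaloisRepresentations.LocalWeilDatum (galFixing)
open Literature.NumberTheory.GaloisRepresentations.SUnits
open Literature.NumberTheory.GaloisRepresentations.SUnits.Layers
open Literature.NumberTheory.IwasawaTheory.Greenberg2006 (galoisGroupAbove)
open Literature.NumberTheory.NumberFields (EquivariantSUnit.sUnitsRepρ EquivariantSUnit.placesAbove)
open Literature.RepresentationTheory.FiniteGroups
open Literature.RepresentationTheory.FiniteGroups.StableLatticeReduction (torsionBy_le_comap smul_top_le_comap)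
open _root_.TopRep _root_.ContRepresentation _root_.ContinuousCohomology
open NumberField Field IsDedekindDomain Submodule
open scoped NumberField Pointwise

/-! ## `hbase` at `K` from the Brauer-class identity -/

/-- **The prime-to-`p` base case `hbase` of Tate's global Euler characteristic at a totally complex `K`,
from the Brauer-class identity alone.**  HYPOTHESIS `hBr`: for every finite `S ⊇ S_p`, every open
`H ≤ Γ_K` containing `N_S`, every finite Galois layer `E` of `K_S` above `K̄^H` and every `ℤ`-valued
invariant `ψ` of `ℤ[Δ]`-modules additive on short exact sequences of finite `p`-torsion modules
(`Δ = Gal(E/K̄^H)` as `↥U ⧸ W_E`), there is a `Δ`-stable `N₂ = 𝓗²(E_S)[p] ≤ 𝓗²(E_S) = H²(↥U, Maps(Δ, E_S))`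
with `ψ(𝓗²(E_S)[p]) + ψ(𝔽_p) = ψ(𝔽_p[S_f(E)])` — the hypothesis `hH2` of
`TateEulerCharacteristicKummerClasses.additive_coindOpen_mu_euler_of_brauerClass`, token for token (NSW
(8.3.11) (iii) read equivariantly through the vector of local invariants; Cassels–Fröhlich VII §7.3
Cor. 7.4 (b)).  CONCLUSION: the hypothesis `hbase` of
`TateGlobalEulerCharacteristicTCOfBase.tateGlobalEulerPoincareCharacteristic_of_isTotallyComplex_of_base`
at `K`, VERBATIM — so that Tate's formula at the totally complex field `K` follows from `hBr` and
`finite_restrictedCohomology_of_isTotallyComplex` by that theorem.  Proof: `baseK_of_layerIdentity`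
(the adapter) fed by the Kummer file.
[cite: MilneADT2006, I Thm. 5.1 (proof, pp. 69–70)] [cite: NeukirchSchmidtWingberg2008, (8.7.4), (8.3.11)]
[cite: CasselsFrohlichANT1967, Ch. VII §7.3 Cor. 7.4 (b)] -/
theorem baseK_of_brauerClass (K : Type) [Field K] [NumberField K] [IsTotallyComplex K]
    (hBr : ∀ (S : Set (HeightOneSpectrum (𝓞 K))), S.Finite →
      ∀ (p : ℕ) [Fact p.Prime], (∀ v : HeightOneSpectrum (𝓞 K), ((p : ℕ) : 𝓞 K) ∈ v.asIdeal → v ∈ S) →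
      ∀ (H : Subgroup (absoluteGaloisGroup K)) (hHo : IsOpen (H : Set (absoluteGaloisGroup K)))
        (hNH : ramificationSubgroup K S ≤ H) (E : GalLayer K) (hF : baseField H ≤ E.1)
        (hS : ramificationSubgroup K S ≤ galFixing K E.1) [NumberField ↥(baseField H)]
        [CompactSpace ↥(galoisGroupAbove S H)]
        (ψ : ∀ ⦃X : Type⦄ ⦃_ : AddCommGroup X⦄ ⦃_ : Module ℤ X⦄,
      Representation ℤ (↥(galoisGroupAbove S H) ⧸
        ((OpenSubgroupLayer.layerSubgroup S hHo E hF hS : OpenNormalSubgroup ↥(galoisGroupAbove S H)) :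
          Subgroup ↥(galoisGroupAbove S H))) X → ℤ)
        (hψ : ∀ ⦃X Y Z : Type⦄ [AddCommGroup X] [Module ℤ X] [AddCommGroup Y] [Module ℤ Y]
      [AddCommGroup Z] [Module ℤ Z]
      (ρX : Representation ℤ (↥(galoisGroupAbove S H) ⧸
        ((OpenSubgroupLayer.layerSubgroup S hHo E hF hS : OpenNormalSubgroup ↥(galoisGroupAbove S H)) :
          Subgroup ↥(galoisGroupAbove S H))) X)
      (ρY : Representation ℤ (↥(galoisGroupAbove S H) ⧸
        ((OpenSubgroupLayer.layerSubgroup S hHo E hF hS : OpenNormalSubgroup ↥(galoisGroupAbove S H)) :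
          Subgroup ↥(galoisGroupAbove S H))) Y)
      (ρZ : Representation ℤ (↥(galoisGroupAbove S H) ⧸
        ((OpenSubgroupLayer.layerSubgroup S hHo E hF hS : OpenNormalSubgroup ↥(galoisGroupAbove S H)) :
          Subgroup ↥(galoisGroupAbove S H))) Z) (f : X →ₗ[ℤ] Y) (g : Y →ₗ[ℤ] Z),
      (∀ s x, f (ρX s x) = ρY s (f x)) → (∀ s y, g (ρY s y) = ρZ s (g y)) →
      Injective f → Surjective g → LinearMap.range f = LinearMap.ker g → Finite Y →
      (∀ y : Y, (p : ℤ) • y = 0) → ψ ρY = ψ ρX + ψ ρZ),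
        ∃ (N₂ : Submodule ℤ (continuousCohomology 2 ((resRep K S H).coindOpen
      ((OpenSubgroupLayer.layerSubgroup S hHo E hF hS : OpenNormalSubgroup ↥(galoisGroupAbove S H)) :
        Subgroup ↥(galoisGroupAbove S H)) (OpenSubgroupLayer.layerSubgroup S hHo E hF hS).isOpen').toTopRep))
          (hN₂st : ∀ c, N₂ ≤ N₂.comap ((resRep K S H).coindOpenHRep
      ((OpenSubgroupLayer.layerSubgroup S hHo E hF hS : OpenNormalSubgroup ↥(galoisGroupAbove S H)) :
        Subgroup ↥(galoisGroupAbove S H)) (OpenSubgroupLayer.layerSubgroup S hHo E hF hS).isOpen' 2 c)),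
          (∀ t, t ∈ N₂ ↔ (p : ℤ) • t = 0) ∧
          (ψ (((resRep K S H).coindOpenHRep
        ((OpenSubgroupLayer.layerSubgroup S hHo E hF hS : OpenNormalSubgroup ↥(galoisGroupAbove S H)) :
          Subgroup ↥(galoisGroupAbove S H)) (OpenSubgroupLayer.layerSubgroup S hHo E hF hS).isOpen' 2).subrepresentation
          N₂ hN₂st) +
      ψ ((Representation.trivial ℤ (↥(galoisGroupAbove S H) ⧸
        ((OpenSubgroupLayer.layerSubgroup S hHo E hF hS : OpenNormalSubgroup ↥(galoisGroupAbove S H)) :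
          Subgroup ↥(galoisGroupAbove S H))) ℤ).quotient ((p : ℤ) • ⊤) (smul_top_le_comap _ (p : ℤ))) =
      (letI := algOfLE hF; haveI := isScalarTower_algOfLE (K := K) hF; haveI := E.numberField;
        ψ (Representation.quotient ((Representation.ofMulAction ℤ (↥E.1 ≃ₐ[↥(baseField H)] ↥E.1)
          (EquivariantSUnit.placesAbove K S ↥(baseField H) ↥E.1)).comp
          (OpenSubgroupLayer.layerEquiv S hHo E hF hS).toMonoidHom) ((p : ℤ) • ⊤) (smul_top_le_comap _ (p : ℤ)))))) :
    ∀ (S : Set (HeightOneSpectrum (𝓞 K))), S.Finite → ∀ (p : ℕ) [Fact p.Prime],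
      (∀ v : HeightOneSpectrum (𝓞 K), ((p : ℕ) : 𝓞 K) ∈ v.asIdeal → v ∈ S) →
      ∀ (ρ₀ : ContinuousRep (GaloisGroupUnramifiedOutside K S) ℤ (MuCarrier K p)),
      (∀ (τ : absoluteGaloisGroup K) (v : MuCarrier K p), ρ₀ (toUnramifiedQuot K S τ) v = mu K p τ v) →
      ∀ (W : Subgroup (GaloisGroupUnramifiedOutside K S)) [W.Normal]
        [DiscreteTopology (GaloisGroupUnramifiedOutside K S ⧸ W)],
        IsOpen (W : Set (GaloisGroupUnramifiedOutside K S)) → (∀ g ∈ W, ∀ v : MuCarrier K p, ρ₀ g v = v) →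
      ∀ (C : Subgroup (GaloisGroupUnramifiedOutside K S ⧸ W))
        [Fintype ((GaloisGroupUnramifiedOutside K S ⧸ W) ⧸ C)], IsCyclic C → (Nat.card C).Coprime p →
      ∀ (M : Type) [AddCommGroup M] [TopologicalSpace M] [DiscreteTopology M] [Finite M]
        (σ : Representation ℤ (GaloisGroupUnramifiedOutside K S ⧸ W) M), (∀ m : M, (p : ℤ) • m = 0) →
        ((padicValNat p (Nat.card (continuousCohomology 0
            (((ContinuousRep.ofDiscrete σ).restrict (ContinuousMonoidHom.quotientMk W)).restrict
              (subgroupIncl (C.comap (QuotientGroup.mk' W)))).toTopRep)) : ℤ) -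
            padicValNat p (Nat.card (continuousCohomology 1
              (((ContinuousRep.ofDiscrete σ).restrict (ContinuousMonoidHom.quotientMk W)).restrict
                (subgroupIncl (C.comap (QuotientGroup.mk' W)))).toTopRep)) +
            padicValNat p (Nat.card (continuousCohomology 2
              (((ContinuousRep.ofDiscrete σ).restrict (ContinuousMonoidHom.quotientMk W)).restrict
                (subgroupIncl (C.comap (QuotientGroup.mk' W)))).toTopRep)) +
          ((C.comap (QuotientGroup.mk' W)).index * InfinitePlace.nrComplexPlaces K : ℕ) *
            padicValNat p (Nat.card M)) = 0 := by
  intro S hS p _ hSp ρ₀ hρ₀ W _ _ hWo hWfix C _ _ hC M _ _ _ _ σ hM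
  exact baseK_of_layerIdentity S hS p hSp ρ₀ hρ₀ W hWo hWfix C hC M σ hM
    (fun H hHo hNH _ E hF hS' _ _ _ _ ψ hψ => by
      have hh := hBr S hS p hSp H hHo hNH E hF hS' ψ hψ
      exact hh.elim fun N₂ h1 => h1.elim fun hN₂st h2 =>
        additive_coindOpen_mu_euler_of_brauerClass hHo hNH hS E hF hS' hSp ψ hψ N₂ h2.1 hN₂st h2.2)


/-! ## Tate's formula at a totally complex `K` from the Brauer-class identity alone -/

/-- **Tate's global Euler–Poincaré characteristic formula (Milne ADT I Thm. 5.1) at a TOTALLY COMPLEX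
number field `K`, GIVEN the Brauer-class identity `hBr`** (the hypothesis of `baseK_of_brauerClass`: for
every finite `S ⊇ S_p`, open `H ≤ Γ_K` above `N_S`, finite Galois layer `E` of `K_S` over `K̄^H` and additive
invariant `ψ` of finite `p`-torsion `ℤ[Gal(E/K̄^H)]`-modules, `ψ(𝓗²(E_S)[p]) + ψ(𝔽_p) = ψ(𝔽_p[S_f(E)])` for a
stable `N₂ = 𝓗²(E_S)[p]`): the named fact `tateGlobalEulerPoincareCharacteristic K` follows — the
composition of the lane's end bricks `tateGlobalEulerPoincareCharacteristic_of_isTotallyComplex_of_base`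
(B9: reduction to `finite_restrictedCohomology K` and the prime-to-`p` base case),
`forall_finite_restrictedCohomology_of_isTotallyComplex` (B1c: Harari Cor. 17.17 / Milne I Cor. 4.15 at
totally complex fields) and `baseK_of_brauerClass` (the base case from `hBr`: adapter ∘ Kummer class
identity).  HONEST FRAMING: CONDITIONAL on `hBr` (NSW (8.3.11) (iii) read equivariantly — the lane's FILE
D); fields with a real place are not covered.
[cite: MilneADT2006, I §5 Thm. 5.1 (pp. 67–70), Cor. 4.15] [cite: NeukirchSchmidtWingberg2008, (8.7.4), (8.3.11), (8.3.20)]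
[cite: CasselsFrohlichANT1967, Ch. VII §7.3 Cor. 7.4 (b)] -/
theorem tateGlobalEulerPoincareCharacteristic_of_isTotallyComplex_of_brauerClass (K : Type) [Field K]
    [NumberField K] [IsTotallyComplex K]
    (hBr : ∀ (S : Set (HeightOneSpectrum (𝓞 K))), S.Finite →
      ∀ (p : ℕ) [Fact p.Prime], (∀ v : HeightOneSpectrum (𝓞 K), ((p : ℕ) : 𝓞 K) ∈ v.asIdeal → v ∈ S) →
      ∀ (H : Subgroup (absoluteGaloisGroup K)) (hHo : IsOpen (H : Set (absoluteGaloisGroup K)))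
        (hNH : ramificationSubgroup K S ≤ H) (E : GalLayer K) (hF : baseField H ≤ E.1)
        (hS : ramificationSubgroup K S ≤ galFixing K E.1) [NumberField ↥(baseField H)]
        [CompactSpace ↥(galoisGroupAbove S H)]
        (ψ : ∀ ⦃X : Type⦄ ⦃_ : AddCommGroup X⦄ ⦃_ : Module ℤ X⦄,
      Representation ℤ (↥(galoisGroupAbove S H) ⧸
        ((OpenSubgroupLayer.layerSubgroup S hHo E hF hS : OpenNormalSubgroup ↥(galoisGroupAbove S H)) :
          Subgroup ↥(galoisGroupAbove S H))) X → ℤ)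
        (hψ : ∀ ⦃X Y Z : Type⦄ [AddCommGroup X] [Module ℤ X] [AddCommGroup Y] [Module ℤ Y]
      [AddCommGroup Z] [Module ℤ Z]
      (ρX : Representation ℤ (↥(galoisGroupAbove S H) ⧸
        ((OpenSubgroupLayer.layerSubgroup S hHo E hF hS : OpenNormalSubgroup ↥(galoisGroupAbove S H)) :
          Subgroup ↥(galoisGroupAbove S H))) X)
      (ρY : Representation ℤ (↥(galoisGroupAbove S H) ⧸
        ((OpenSubgroupLayer.layerSubgroup S hHo E hF hS : OpenNormalSubgroup ↥(galoisGroupAbove S H)) :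
          Subgroup ↥(galoisGroupAbove S H))) Y)
      (ρZ : Representation ℤ (↥(galoisGroupAbove S H) ⧸
        ((OpenSubgroupLayer.layerSubgroup S hHo E hF hS : OpenNormalSubgroup ↥(galoisGroupAbove S H)) :
          Subgroup ↥(galoisGroupAbove S H))) Z) (f : X →ₗ[ℤ] Y) (g : Y →ₗ[ℤ] Z),
      (∀ s x, f (ρX s x) = ρY s (f x)) → (∀ s y, g (ρY s y) = ρZ s (g y)) →
      Injective f → Surjective g → LinearMap.range f = LinearMap.ker g → Finite Y →
      (∀ y : Y, (p : ℤ) • y = 0) → ψ ρY = ψ ρX + ψ ρZ),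
        ∃ (N₂ : Submodule ℤ (continuousCohomology 2 ((resRep K S H).coindOpen
      ((OpenSubgroupLayer.layerSubgroup S hHo E hF hS : OpenNormalSubgroup ↥(galoisGroupAbove S H)) :
        Subgroup ↥(galoisGroupAbove S H)) (OpenSubgroupLayer.layerSubgroup S hHo E hF hS).isOpen').toTopRep))
          (hN₂st : ∀ c, N₂ ≤ N₂.comap ((resRep K S H).coindOpenHRep
      ((OpenSubgroupLayer.layerSubgroup S hHo E hF hS : OpenNormalSubgroup ↥(galoisGroupAbove S H)) :
        Subgroup ↥(galoisGroupAbove S H)) (OpenSubgroupLayer.layerSubgroup S hHo E hF hS).isOpen' 2 c)),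
          (∀ t, t ∈ N₂ ↔ (p : ℤ) • t = 0) ∧
          (ψ (((resRep K S H).coindOpenHRep
        ((OpenSubgroupLayer.layerSubgroup S hHo E hF hS : OpenNormalSubgroup ↥(galoisGroupAbove S H)) :
          Subgroup ↥(galoisGroupAbove S H)) (OpenSubgroupLayer.layerSubgroup S hHo E hF hS).isOpen' 2).subrepresentation
          N₂ hN₂st) +
      ψ ((Representation.trivial ℤ (↥(galoisGroupAbove S H) ⧸
        ((OpenSubgroupLayer.layerSubgroup S hHo E hF hS : OpenNormalSubgroup ↥(galoisGroupAbove S H)) :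
          Subgroup ↥(galoisGroupAbove S H))) ℤ).quotient ((p : ℤ) • ⊤) (smul_top_le_comap _ (p : ℤ))) =
      (letI := algOfLE hF; haveI := isScalarTower_algOfLE (K := K) hF; haveI := E.numberField;
        ψ (Representation.quotient ((Representation.ofMulAction ℤ (↥E.1 ≃ₐ[↥(baseField H)] ↥E.1)
          (EquivariantSUnit.placesAbove K S ↥(baseField H) ↥E.1)).comp
          (OpenSubgroupLayer.layerEquiv S hHo E hF hS).toMonoidHom) ((p : ℤ) • ⊤) (smul_top_le_comap _ (p : ℤ)))))) :
    tateGlobalEulerPoincareCharacteristic K :=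
  tateGlobalEulerPoincareCharacteristic_of_isTotallyComplex_of_base K
    (forall_finite_restrictedCohomology_of_isTotallyComplex K) (baseK_of_brauerClass K hBr)

end Literature.NumberTheory.GaloisCohomology

end
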